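import Literature.Computability.AlgebraicComplexity.EGOW2018RankMeasures
import Mathlib.LinearAlgebra.Dual.Lemmas
import HarnessLib

/-!
# EGOW 2018 §5 — the rank method restated through the symbolic matrix `L(ψ)`
(cell val-lit, typer t22, DAG row EGOW2018-B; source `paper:arxiv-1710.09502`;
bib `EfremenkoGargOliveiraWigderson2018`)

K. Efremenko, A. Garg, R. Oliveira, A. Wigderson, *Barriers for rank methods in arithmetic
complexity*, ITCS 2018 = arXiv:1710.09502, §5 "Approach to proving lower bounds", paragraph
**Restatement of the rank methods** (p. 15; locators `pNNNN.txt:Lnn` are the chunks of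
`lit read arxiv:1710.09502`). Companion of `EGOW2018RankMeasures.lean` (§2–§3 and the §5 model
`HasDepthThreeForm` / `S_D` / `ψ`), which this file imports. HONEST FRAMING: known linear algebra,
typed and proved; `VP ≠ VNP` is NOT proved and nothing here is progress on it.

## The printed paragraph (p0015:L18–24)

"let `S ⊂ Ŝ` be a set of simple polynomials and let `ψ : F^t → Ŝ` be a polynomial mapping such that
image of `ψ` is `S`. … Let `y = (y_1, …, y_t)` and define `𝓛_S = {ℓ(ψ) : ℓ ∈ Ŝ^*} ⊂ F[y]`. Then, there
exists a rank method which proves a lower bound of `R` for the circuit class `Ŝ` if and only if there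
exists a matrix `L` with entries from `𝓛` such that `rk_{F(y)}(L) ≤ r` and `rk(𝒞(L)) ≥ rR` for some
`r`."

## How it is typed (tree vocabulary; nothing restated)

* The parametrisation `ψ` is a polynomial in the `x`-variables with coefficients in `F[y]`,
  `Ψ : MvPolynomial σ (MvPolynomial τ F)` — exactly the shape of the tree's `depthThreePsi`
  (`EGOW2018RankMeasures.lean`); its value at `a ∈ F^τ` is `MvPolynomial.map (eval a) Ψ`, its image is
  `paramImage Ψ = S`, and `Ŝ = Submodule.span F (paramImage Ψ)`.
* `ℓ(ψ)` for a linear functional `ℓ ∈ F[x]^*` is `applyFunctional Ψ ℓ ∈ F[y]` (apply `ℓ` to the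
  `F[x]`-valued coefficients of `ψ`), and `𝓛_S = entrySpace Ψ` is the set of all `ℓ(ψ)` (a subspace of
  `F[y]`; the paper's `ℓ ∈ Ŝ^*` and our `ℓ ∈ F[x]^*` give the same set, since functionals on `Ŝ` extend
  to `F[x]` and `ℓ(ψ)` only depends on `ℓ|_Ŝ`, `applyFunctional_eq_zero_of_forall`).
* "a matrix `L` with entries from `𝓛`" built from a rank method `L : Ŝ → Mat_m(F)` is the **symbolic
  matrix** `symbolicImage L Ψ = L(ψ) ∈ Mat_m(F[y])`; conversely every matrix with entries in `𝓛` is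
  `L(ψ)` for the linear map `L = matrixOfFunctionals ℓ` assembled from functionals realising its entries
  (`symbolicImage_matrixOfFunctionals`).
* `rk_{F(y)}` is the tree's `symbolicRank`, `𝒞(·)` its `coeffSpace` (Def 2.9), the rank of a SET of
  matrices its `matrixSetRank` (Def 2.5), `μ_L(f) = rank L(f)` its `rankMeasure` (§1.1,
  `RankMethodBarriers.lean`); "`μ_L(S)`", the measure of the simple set, is `matrixSetRank (L '' S)`.
* "a rank method `μ_L` proves a lower bound of `R` for `Ŝ`" is read, as in §1.1 ("`c_S(f) ≥ μ(f)/μ(S)`",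
  tree `rankMeasure_div_le_sComplexity`), multiplicatively and junk-free: some `f ∈ Ŝ` has
  `μ_L(f) ≥ R · μ_L(S)`.

## What is proved

* The two identities behind the paragraph, for an infinite field (the paper's standing assumption is
  characteristic zero, §2.1): **`μ_L(S) = rk_{F(y)}(L(ψ))`** (`matrixSetRank_image_paramImage`, by
  Prop 2.6 / Lemma 2.7 of the tree: `rank_map_eval_le_symbolicRank`,
  `exists_symbolicRank_le_rank_map_eval`) and **`L(Ŝ) = 𝒞(L(ψ))`** (`coeffSpace_symbolicImage`), whose
  engine is `span_paramImage_eq_span_yCoeff`: over an infinite field the span of the values of a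
  polynomial map equals the span of its coefficient vectors (one inclusion is expansion in monomials,
  the other is duality + `MvPolynomial.funext`).
* **The restatement itself**, for a fixed rank method (`EGOW2018_sec5_restatement`) and in the printed
  form quantifying over methods on one side and over matrices with entries from `𝓛_S` on the other
  (`EGOW2018_sec5_restatement_entries`); both are `↔` and both PROVED.
* The depth-3 instantiation: `S_D = image of ψ` (`depthThreeSimple_eq_paramImage`, from the tree's
  `map_eval_depthThreePsi`), so the bullets of p. 16 ("Let `r` be the rank of the symbolic matrix
  `L(ψ)`"; "show that the rank of the space of matrices given by `L(Ŝ_D)` is at least `r · R`") are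
  `symbolicRank_symbolicImage_depthThreePsi`, `matrixSetRank_coeffSpace_depthThreePsi` and
  `EGOW2018_sec5_restatement_depthThree`; polynomials with a depth-3 form lie in `Ŝ_D`
  (`mem_span_depthThreeSimple_of_hasDepthThreeForm`).
* Erratum note for eq. (5.1) (p0015:L49–53, raised by the cell's second referee): the print has
  `ψ(y) = H_{2d}[∏_{i=1}^{D} (1 + ∑_j y_{ij} x_j)]`. Read in the JOINT grading of `F[x, y]` (each `y_{ij} x_j`
  has degree 2) `H_{2d}` is correct; read in the `x`-grading over `F[y]` it is `H_d`. Both give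
  `Sym_d(∑_j y_{1j} x_j, …, ∑_j y_{Dj} x_j)`, the tree's `depthThreePsi`; we PROVE the `x`-grading form
  `homogeneousComponent_prod_one_add_eq_depthThreePsi`.

The further §5 claim `𝓛 = SSM(y)` (set-symmetric multilinear polynomials, p0015:L58–78) is the
subject of the sibling file `EGOW2018SetSymmetric.lean`.

## References

* [EfremenkoGargOliveiraWigderson2018] K. Efremenko, A. Garg, R. Oliveira, A. Wigderson,
  *Barriers for rank methods in arithmetic complexity*, ITCS 2018, LIPIcs 94, 1:1–1:19;
  arXiv:1710.09502, §5 (pp. 15–16), §2.2–2.3 (pp. 8–9).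
-/

noncomputable section

open MvPolynomial Finsupp

namespace Literature.Computability.AlgebraicComplexity

/-! ## Polynomial parametrisations `ψ : F^τ → F[x]` given as `Ψ ∈ F[y][x]` -/

section Parametrisation

variable {F : Type*} [Field F] {σ τ : Type*}

/-- **The image `S` of the parametrisation** `ψ : F^t → Ŝ` ("such that image of `ψ` is `S`", p. 15):
for `Ψ ∈ F[y][x]` (a polynomial in `x` with coefficients in `F[y]`, `y = (y_1, …, y_t)`), the set of its
values `ψ(a) = Ψ|_{y ↦ a} ∈ F[x]`, `a ∈ F^t`. [cite: EfremenkoGargOliveiraWigderson2018, §5, p. 15] locator: paper:arxiv-1710.09502 p0015.txt:L18 -/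
def paramImage (Ψ : MvPolynomial σ (MvPolynomial τ F)) : Set (MvPolynomial σ F) :=
  Set.range fun a : τ → F => MvPolynomial.map (eval a) Ψ

/-- Every value `ψ(a)` lies in the image. [cite: EfremenkoGargOliveiraWigderson2018, §5, p. 15] locator: paper:arxiv-1710.09502 p0015.txt:L18 -/
theorem map_eval_mem_paramImage (Ψ : MvPolynomial σ (MvPolynomial τ F)) (a : τ → F) :
    MvPolynomial.map (eval a) Ψ ∈ paramImage Ψ :=
  ⟨a, rfl⟩

/-- **The `y`-coefficient vectors of `ψ`:** writing `ψ(y) = ∑_e y^e · c_e` with `c_e ∈ F[x]`, `yCoeff e Ψ`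
is `c_e` (its `x^m`-coefficient is the `y^e`-coefficient of the `x^m`-coefficient of `Ψ`). These are the
vectors whose span is `Ŝ` over an infinite field (`span_paramImage_eq_span_yCoeff`).
[cite: EfremenkoGargOliveiraWigderson2018, §5 (proof of the restatement), p. 15] locator: paper:arxiv-1710.09502 p0015.txt:L20 -/
def yCoeff (e : τ →₀ ℕ) (Ψ : MvPolynomial σ (MvPolynomial τ F)) : MvPolynomial σ F :=
  ∑ m ∈ Ψ.support, monomial m (coeff e (coeff m Ψ))

/-- Coefficients of `yCoeff`: `coeff_m (c_e) = coeff_e (coeff_m Ψ)`. [cite: EfremenkoGargOliveiraWigderson2018, §5 (proof of the restatement), p. 15] locator: paper:arxiv-1710.09502 p0015.txt:L20 -/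
theorem coeff_yCoeff (e : τ →₀ ℕ) (Ψ : MvPolynomial σ (MvPolynomial τ F)) (m : σ →₀ ℕ) :
    coeff m (yCoeff e Ψ) = coeff e (coeff m Ψ) := by
  classical
  rw [yCoeff, coeff_sum]
  simp_rw [coeff_monomial]
  rw [Finset.sum_ite_eq']
  split_ifs with h
  · rfl
  · rw [MvPolynomial.notMem_support_iff.1 h, coeff_zero]

/-- A monomial with coefficient `c` is `c • x^m`. [cite: EfremenkoGargOliveiraWigderson2018, §2.1, p. 8] locator: paper:arxiv-1710.09502 p0008.txt:L20 -/
theorem monomial_eq_smul_monomial_one {R : Type*} [CommSemiring R] {ι : Type*} (m : ι →₀ ℕ) (c : R) :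
    (monomial m c : MvPolynomial ι R) = c • monomial m 1 := by
  rw [smul_monomial, smul_eq_mul, mul_one]

/-- **Expansion of a value over the `x`-monomials:** `ψ(a) = ∑_m (coeff_m Ψ)(a) · x^m`. [cite: EfremenkoGargOliveiraWigderson2018, §5 (proof of the restatement), p. 15] locator: paper:arxiv-1710.09502 p0015.txt:L20 -/
theorem map_eval_eq_sum_monomial (Ψ : MvPolynomial σ (MvPolynomial τ F)) (a : τ → F) :
    MvPolynomial.map (eval a) Ψ = ∑ m ∈ Ψ.support, monomial m (eval a (coeff m Ψ)) := by
  conv_lhs => rw [Ψ.as_sum]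
  rw [map_sum]
  exact Finset.sum_congr rfl fun m _ => by rw [map_monomial]

/-- Evaluation through the coefficients on a superset of the support: `q(a) = ∑_{e ∈ E} a^e · coeff_e q`.
[cite: EfremenkoGargOliveiraWigderson2018, Def 2.9, p. 9] locator: paper:arxiv-1710.09502 p0009.txt:L47 -/
theorem eval_eq_sum_coeff_of_support_subset (q : MvPolynomial τ F) {E : Finset (τ →₀ ℕ)}
    (hq : q.support ⊆ E) (a : τ → F) :
    eval a q = ∑ e ∈ E, eval a (monomial e 1) * coeff e q := by
  conv_lhs => rw [q.as_sum, map_sum]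
  rw [Finset.sum_subset hq]
  · refine Finset.sum_congr rfl fun e _ => ?_
    rw [eval_monomial, eval_monomial, one_mul, mul_comm]
  · intro e _ he
    rw [MvPolynomial.notMem_support_iff.mp he, map_zero, map_zero]

/-- **Values lie in the span of the coefficient vectors:** `ψ(a) = ∑_e a^e · c_e ∈ span{c_e}` (any
field). [cite: EfremenkoGargOliveiraWigderson2018, §5 (proof of the restatement), p. 15] locator: paper:arxiv-1710.09502 p0015.txt:L20 -/
theorem map_eval_mem_span_yCoeff (Ψ : MvPolynomial σ (MvPolynomial τ F)) (a : τ → F) :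
    MvPolynomial.map (eval a) Ψ ∈ Submodule.span F (Set.range fun e : τ →₀ ℕ => yCoeff e Ψ) := by
  classical
  set E : Finset (τ →₀ ℕ) := Ψ.support.biUnion fun m => (coeff m Ψ).support with hE
  have hsub : ∀ m ∈ Ψ.support, (coeff m Ψ).support ⊆ E := fun m hm =>
    Finset.subset_biUnion_of_mem (fun m => (coeff m Ψ).support) hm
  have key : MvPolynomial.map (eval a) Ψ = ∑ e ∈ E, eval a (monomial e 1) • yCoeff e Ψ := by
    rw [map_eval_eq_sum_monomial]
    simp_rw [yCoeff, Finset.smul_sum, smul_monomial, smul_eq_mul]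
    rw [Finset.sum_comm]
    refine Finset.sum_congr rfl fun m hm => ?_
    rw [← map_sum (monomial m), eval_eq_sum_coeff_of_support_subset _ (hsub m hm) a]
  rw [key]
  exact Submodule.sum_mem _ fun e _ => Submodule.smul_mem _ _ (Submodule.subset_span ⟨e, rfl⟩)

/-! ### `ℓ(ψ)` and the entry space `𝓛_S` -/

/-- **`ℓ(ψ) ∈ F[y]`** for a linear functional `ℓ` on `F[x]`: apply `ℓ` to the `F[x]`-valued coefficients of
`ψ`, i.e. `ℓ(ψ) = ∑_m ℓ(x^m) · coeff_m(Ψ)` — linear in `ℓ` ("`𝓛_S = {ℓ(ψ) : ℓ ∈ Ŝ^*} ⊂ F[y]`", p. 15).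
[cite: EfremenkoGargOliveiraWigderson2018, §5, p. 15] locator: paper:arxiv-1710.09502 p0015.txt:L21 -/
def applyFunctional (Ψ : MvPolynomial σ (MvPolynomial τ F)) :
    Module.Dual F (MvPolynomial σ F) →ₗ[F] MvPolynomial τ F where
  toFun ℓ := ∑ m ∈ Ψ.support, ℓ (monomial m 1) • coeff m Ψ
  map_add' ℓ ℓ' := by
    simp only [LinearMap.add_apply, add_smul, Finset.sum_add_distrib]
  map_smul' c ℓ := by
    simp only [LinearMap.smul_apply, RingHom.id_apply, Finset.smul_sum, smul_smul, smul_eq_mul]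

/-- Unfolding lemma for `ℓ(ψ)`. [cite: EfremenkoGargOliveiraWigderson2018, §5, p. 15] locator: paper:arxiv-1710.09502 p0015.txt:L21 -/
theorem applyFunctional_apply (Ψ : MvPolynomial σ (MvPolynomial τ F))
    (ℓ : Module.Dual F (MvPolynomial σ F)) :
    applyFunctional Ψ ℓ = ∑ m ∈ Ψ.support, ℓ (monomial m 1) • coeff m Ψ :=
  rfl

/-- **`ℓ(ψ)(a) = ℓ(ψ(a))`:** evaluating the polynomial `ℓ(ψ)` at `a` is applying `ℓ` to the value `ψ(a)`
(the reason a matrix with entries from `𝓛` evaluates to the rank method applied to simple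
polynomials). [cite: EfremenkoGargOliveiraWigderson2018, §5, p. 15] locator: paper:arxiv-1710.09502 p0015.txt:L21 -/
theorem eval_applyFunctional (Ψ : MvPolynomial σ (MvPolynomial τ F))
    (ℓ : Module.Dual F (MvPolynomial σ F)) (a : τ → F) :
    eval a (applyFunctional Ψ ℓ) = ℓ (MvPolynomial.map (eval a) Ψ) := by
  rw [applyFunctional_apply, map_sum, map_eval_eq_sum_monomial, map_sum]
  refine Finset.sum_congr rfl fun m _ => ?_
  rw [smul_eval, monomial_eq_smul_monomial_one m (eval a (coeff m Ψ)), map_smul, smul_eq_mul, mul_comm]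

/-- **Coefficients of `ℓ(ψ)`:** the `y^e`-coefficient of `ℓ(ψ)` is `ℓ(c_e)`, `c_e = yCoeff e Ψ`.
[cite: EfremenkoGargOliveiraWigderson2018, §5, p. 15] locator: paper:arxiv-1710.09502 p0015.txt:L21 -/
theorem coeff_applyFunctional (Ψ : MvPolynomial σ (MvPolynomial τ F))
    (ℓ : Module.Dual F (MvPolynomial σ F)) (e : τ →₀ ℕ) :
    coeff e (applyFunctional Ψ ℓ) = ℓ (yCoeff e Ψ) := by
  rw [applyFunctional_apply, coeff_sum, yCoeff, map_sum]
  refine Finset.sum_congr rfl fun m _ => ?_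
  rw [coeff_smul, monomial_eq_smul_monomial_one m (coeff e (coeff m Ψ)), map_smul, smul_eq_mul,
    smul_eq_mul, mul_comm]

/-- `ℓ(ψ)` for the coordinate functional `ℓ = coeff_m` is the `x^m`-coefficient of `Ψ` ("we can take the
standard linear functionals corresponding to each coordinate", p. 15). [cite: EfremenkoGargOliveiraWigderson2018, §5, p. 15] locator: paper:arxiv-1710.09502 p0015.txt:L72 -/
theorem applyFunctional_lcoeff (Ψ : MvPolynomial σ (MvPolynomial τ F)) (m : σ →₀ ℕ) :
    applyFunctional Ψ (lcoeff F m) = coeff m Ψ := by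
  classical
  rw [applyFunctional_apply]
  simp_rw [lcoeff_apply, coeff_monomial, ite_smul, one_smul, zero_smul]
  rw [Finset.sum_ite_eq']
  split_ifs with h
  · rfl
  · exact (MvPolynomial.notMem_support_iff.1 h).symm

variable [Infinite F] in
/-- Over an infinite field, `ℓ(ψ) = 0` as soon as `ℓ` vanishes on every value `ψ(a)` — so `ℓ(ψ)` only
depends on the restriction of `ℓ` to `Ŝ = span(S)` (the paper's `ℓ ∈ Ŝ^*`).
[cite: EfremenkoGargOliveiraWigderson2018, §5, p. 15] locator: paper:arxiv-1710.09502 p0015.txt:L21 -/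
theorem applyFunctional_eq_zero_of_forall (Ψ : MvPolynomial σ (MvPolynomial τ F))
    (ℓ : Module.Dual F (MvPolynomial σ F)) (h : ∀ a : τ → F, ℓ (MvPolynomial.map (eval a) Ψ) = 0) :
    applyFunctional Ψ ℓ = 0 :=
  MvPolynomial.funext fun a => by rw [eval_applyFunctional, h a, map_zero]

variable [Infinite F] in
/-- **Coefficient vectors lie in the span of the values** (infinite field): `c_e ∈ span{ψ(a) : a}`.
Duality: a functional killing all values kills `ℓ(ψ)` (`applyFunctional_eq_zero_of_forall`), hence its
coefficients `ℓ(c_e)`. [cite: EfremenkoGargOliveiraWigderson2018, §5 (proof of the restatement), p. 15] locator: paper:arxiv-1710.09502 p0015.txt:L20 -/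
theorem yCoeff_mem_span_paramImage (Ψ : MvPolynomial σ (MvPolynomial τ F)) (e : τ →₀ ℕ) :
    yCoeff e Ψ ∈ Submodule.span F (paramImage Ψ) := by
  by_contra h
  obtain ⟨φ, hφe, hφW⟩ := Submodule.exists_dual_map_eq_bot_of_notMem h inferInstance
  apply hφe
  have h0 : applyFunctional Ψ φ = 0 := by
    refine applyFunctional_eq_zero_of_forall Ψ φ fun a => ?_
    have hmem : φ (MvPolynomial.map (eval a) Ψ) ∈ (Submodule.span F (paramImage Ψ)).map φ :=
      Submodule.mem_map_of_mem (Submodule.subset_span (map_eval_mem_paramImage Ψ a))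
    rw [hφW] at hmem
    exact (Submodule.mem_bot F).1 hmem
  rw [← coeff_applyFunctional, h0, coeff_zero]

variable [Infinite F] in
/-- **`Ŝ = span{c_e}`:** over an infinite field the span of the image of a polynomial map is the span of
its coefficient vectors. [cite: EfremenkoGargOliveiraWigderson2018, §5 (proof of the restatement), p. 15] locator: paper:arxiv-1710.09502 p0015.txt:L20 -/
theorem span_paramImage_eq_span_yCoeff (Ψ : MvPolynomial σ (MvPolynomial τ F)) :
    Submodule.span F (paramImage Ψ) = Submodule.span F (Set.range fun e : τ →₀ ℕ => yCoeff e Ψ) := by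
  refine le_antisymm (Submodule.span_le.2 ?_) (Submodule.span_le.2 ?_)
  · rintro _ ⟨a, rfl⟩
    exact map_eval_mem_span_yCoeff Ψ a
  · rintro _ ⟨e, rfl⟩
    exact yCoeff_mem_span_paramImage Ψ e

/-- **The entry space `𝓛_S = {ℓ(ψ) : ℓ ∈ Ŝ^*} ⊂ F[y]`** (p. 15), as the range of `ℓ ↦ ℓ(ψ)` — a linear
subspace of `F[y]`. [cite: EfremenkoGargOliveiraWigderson2018, §5, p. 15] locator: paper:arxiv-1710.09502 p0015.txt:L21 -/
def entrySpace (Ψ : MvPolynomial σ (MvPolynomial τ F)) : Submodule F (MvPolynomial τ F) :=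
  LinearMap.range (applyFunctional Ψ)

/-- Membership in `𝓛_S`. [cite: EfremenkoGargOliveiraWigderson2018, §5, p. 15] locator: paper:arxiv-1710.09502 p0015.txt:L21 -/
theorem mem_entrySpace_iff {Ψ : MvPolynomial σ (MvPolynomial τ F)} {q : MvPolynomial τ F} :
    q ∈ entrySpace Ψ ↔ ∃ ℓ : Module.Dual F (MvPolynomial σ F), applyFunctional Ψ ℓ = q :=
  LinearMap.mem_range

/-- Every `ℓ(ψ)` is in `𝓛_S`. [cite: EfremenkoGargOliveiraWigderson2018, §5, p. 15] locator: paper:arxiv-1710.09502 p0015.txt:L21 -/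
theorem applyFunctional_mem_entrySpace (Ψ : MvPolynomial σ (MvPolynomial τ F))
    (ℓ : Module.Dual F (MvPolynomial σ F)) : applyFunctional Ψ ℓ ∈ entrySpace Ψ :=
  LinearMap.mem_range_self _ _

/-- The `x^m`-coefficients of `Ψ` are in `𝓛_S` (coordinate functionals). [cite: EfremenkoGargOliveiraWigderson2018, §5, p. 15] locator: paper:arxiv-1710.09502 p0015.txt:L72 -/
theorem coeff_mem_entrySpace (Ψ : MvPolynomial σ (MvPolynomial τ F)) (m : σ →₀ ℕ) :
    coeff m Ψ ∈ entrySpace Ψ := by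
  rw [← applyFunctional_lcoeff]
  exact applyFunctional_mem_entrySpace _ _

/-- **`𝓛_S` is spanned by the `x`-coefficients of `Ψ`** ("the coefficients in `y` of each coordinate",
p. 15). [cite: EfremenkoGargOliveiraWigderson2018, §5, p. 15] locator: paper:arxiv-1710.09502 p0015.txt:L72 -/
theorem entrySpace_eq_span_coeff (Ψ : MvPolynomial σ (MvPolynomial τ F)) :
    entrySpace Ψ = Submodule.span F (Set.range fun m : σ →₀ ℕ => coeff m Ψ) := by
  refine le_antisymm ?_ (Submodule.span_le.2 ?_)
  · rintro _ ⟨ℓ, rfl⟩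
    rw [applyFunctional_apply]
    exact Submodule.sum_mem _ fun m _ => Submodule.smul_mem _ _ (Submodule.subset_span ⟨m, rfl⟩)
  · rintro _ ⟨m, rfl⟩
    exact coeff_mem_entrySpace Ψ m

/-! ### The symbolic matrix `L(ψ)` of a rank method `L` -/

variable {ι : Type*}

/-- **The symbolic matrix `L(ψ) ∈ Mat(F[y])`** of a linear map `L : F[x] → Mat(F)`: its `(i, j)` entry is
`ℓ_{ij}(ψ)` for the functional `ℓ_{ij} = (L ·)_{ij}` — "a matrix `L` with entries from `𝓛`" (p. 15;
§1.3: "we view the linear map `L` … as a matrix polynomial … Call this symbolic matrix `L(S)`").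
[cite: EfremenkoGargOliveiraWigderson2018, §5, p. 15] locator: paper:arxiv-1710.09502 p0015.txt:L22 -/
def symbolicImage (L : MvPolynomial σ F →ₗ[F] Matrix ι ι F) (Ψ : MvPolynomial σ (MvPolynomial τ F)) :
    Matrix ι ι (MvPolynomial τ F) :=
  Matrix.of fun i j => applyFunctional Ψ ((Matrix.entryLinearMap F F i j).comp L)

/-- Entries of `L(ψ)`. [cite: EfremenkoGargOliveiraWigderson2018, §5, p. 15] locator: paper:arxiv-1710.09502 p0015.txt:L22 -/
theorem symbolicImage_apply (L : MvPolynomial σ F →ₗ[F] Matrix ι ι F)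
    (Ψ : MvPolynomial σ (MvPolynomial τ F)) (i j : ι) :
    symbolicImage L Ψ i j = applyFunctional Ψ ((Matrix.entryLinearMap F F i j).comp L) :=
  rfl

/-- The entries of `L(ψ)` are from `𝓛_S`. [cite: EfremenkoGargOliveiraWigderson2018, §5, p. 15] locator: paper:arxiv-1710.09502 p0015.txt:L22 -/
theorem symbolicImage_mem_entrySpace (L : MvPolynomial σ F →ₗ[F] Matrix ι ι F)
    (Ψ : MvPolynomial σ (MvPolynomial τ F)) (i j : ι) : symbolicImage L Ψ i j ∈ entrySpace Ψ :=
  applyFunctional_mem_entrySpace _ _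

/-- **`L(ψ)(a) = L(ψ(a))`:** the evaluations of the symbolic matrix are the values of the rank method on
the simple polynomials (§1.3, second bullet). [cite: EfremenkoGargOliveiraWigderson2018, §1.3 and §5, p. 15] locator: paper:arxiv-1710.09502 p0015.txt:L22 -/
theorem symbolicImage_map_eval (L : MvPolynomial σ F →ₗ[F] Matrix ι ι F)
    (Ψ : MvPolynomial σ (MvPolynomial τ F)) (a : τ → F) :
    (symbolicImage L Ψ).map (eval a) = L (MvPolynomial.map (eval a) Ψ) := by
  ext i j
  rw [Matrix.map_apply, symbolicImage_apply, eval_applyFunctional]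
  rfl

/-- **Coefficient matrices of `L(ψ)`:** `coeff_e L(ψ) = L(c_e)`. [cite: EfremenkoGargOliveiraWigderson2018, §5, p. 15] locator: paper:arxiv-1710.09502 p0015.txt:L22 -/
theorem symbolicImage_map_coeff (L : MvPolynomial σ F →ₗ[F] Matrix ι ι F)
    (Ψ : MvPolynomial σ (MvPolynomial τ F)) (e : τ →₀ ℕ) :
    (symbolicImage L Ψ).map (coeff e) = L (yCoeff e Ψ) := by
  ext i j
  rw [Matrix.map_apply, symbolicImage_apply, coeff_applyFunctional]
  rfl

/-- **The linear map assembled from a matrix of functionals** `(ℓ_{ij})`: `f ↦ (ℓ_{ij}(f))_{ij}` — the rank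
method whose symbolic matrix is a given matrix with entries `ℓ_{ij}(ψ) ∈ 𝓛`
(`symbolicImage_matrixOfFunctionals`). [cite: EfremenkoGargOliveiraWigderson2018, §5, p. 15] locator: paper:arxiv-1710.09502 p0015.txt:L22 -/
def matrixOfFunctionals {V : Type*} [AddCommGroup V] [Module F V] (ℓ : ι → ι → Module.Dual F V) :
    V →ₗ[F] Matrix ι ι F where
  toFun f := Matrix.of fun i j => ℓ i j f
  map_add' f g := by
    ext i j
    simp only [Matrix.of_apply, map_add, Matrix.add_apply]
  map_smul' c f := by
    ext i j
    simp only [Matrix.of_apply, map_smul, RingHom.id_apply, Matrix.smul_apply]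

/-- Entries of `matrixOfFunctionals`. [cite: EfremenkoGargOliveiraWigderson2018, §5, p. 15] locator: paper:arxiv-1710.09502 p0015.txt:L22 -/
theorem matrixOfFunctionals_apply {V : Type*} [AddCommGroup V] [Module F V]
    (ℓ : ι → ι → Module.Dual F V) (f : V) (i j : ι) : matrixOfFunctionals ℓ f i j = ℓ i j f :=
  rfl

/-- The symbolic matrix of `matrixOfFunctionals ℓ` is `(ℓ_{ij}(ψ))_{ij}`: every matrix with entries from
`𝓛_S` is an `L(ψ)`. [cite: EfremenkoGargOliveiraWigderson2018, §5, p. 15] locator: paper:arxiv-1710.09502 p0015.txt:L22 -/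
theorem symbolicImage_matrixOfFunctionals (ℓ : ι → ι → Module.Dual F (MvPolynomial σ F))
    (Ψ : MvPolynomial σ (MvPolynomial τ F)) :
    symbolicImage (matrixOfFunctionals ℓ) Ψ = Matrix.of fun i j => applyFunctional Ψ (ℓ i j) := by
  ext i j
  rw [symbolicImage_apply, Matrix.of_apply]
  congr 1

/-- The rank of a non-empty set of matrices is attained by a member (the ranks are bounded by the number
of columns; used to read "`rk(𝒞(L)) ≥ rR`" as the existence of a witness `f ∈ Ŝ`).
[cite: EfremenkoGargOliveiraWigderson2018, Def 2.5, p. 8] locator: paper:arxiv-1710.09502 p0008.txt:L105 -/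
theorem exists_rank_eq_matrixSetRank {m n : Type*} [Fintype n] {𝓜 : Set (Matrix m n F)}
    (h : 𝓜.Nonempty) : ∃ M ∈ 𝓜, M.rank = matrixSetRank 𝓜 := by
  have hb : BddAbove ((fun M : Matrix m n F => M.rank) '' 𝓜) :=
    ⟨Fintype.card n, by rintro _ ⟨N, -, rfl⟩; exact Matrix.rank_le_card_width N⟩
  obtain ⟨M, hM, hMr⟩ := Nat.sSup_mem (h.image _) hb
  exact ⟨M, hM, hMr⟩

variable [Fintype ι]

variable [Infinite F] in
/-- **`μ_L(S) = rk_{F(y)}(L(ψ))`** (infinite field): the largest rank of `L` on the simple polynomials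
`S = ψ(F^t)` is the symbolic rank of `L(ψ)` — Prop 2.6 / Lemma 2.7 for the parametrisation `ψ` (§1.3:
"the symbolic rank of `L(S)` … is bounded by the maximum rank of any evaluation … and so is the symbolic
rank"). [cite: EfremenkoGargOliveiraWigderson2018, §5 and Prop 2.6, p. 15] locator: paper:arxiv-1710.09502 p0015.txt:L23 -/
theorem matrixSetRank_image_paramImage (L : MvPolynomial σ F →ₗ[F] Matrix ι ι F)
    (Ψ : MvPolynomial σ (MvPolynomial τ F)) :
    matrixSetRank (L '' paramImage Ψ) = symbolicRank (symbolicImage L Ψ) := by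
  refine le_antisymm (matrixSetRank_le ?_) ?_
  · rintro _ ⟨_, ⟨a, rfl⟩, rfl⟩
    rw [← symbolicImage_map_eval]
    exact rank_map_eval_le_symbolicRank _ _
  · obtain ⟨b, hb⟩ := exists_symbolicRank_le_rank_map_eval (symbolicImage L Ψ)
    rw [symbolicImage_map_eval] at hb
    exact hb.trans (rank_le_matrixSetRank ⟨_, map_eval_mem_paramImage Ψ b, rfl⟩)

omit [Fintype ι] in
variable [Infinite F] in
/-- **`𝒞(L(ψ)) = L(Ŝ)`** (infinite field): the coefficient space of the symbolic matrix is the image of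
the span of the simple polynomials under `L` (§1.3, last bullet: "every matrix `L(f)` with `f ∈ Ŝ` is also
in the linear span of the matrices `{L(g) : g ∈ S}`"). [cite: EfremenkoGargOliveiraWigderson2018, §5 and §1.3, p. 15] locator: paper:arxiv-1710.09502 p0015.txt:L23 -/
theorem coeffSpace_symbolicImage (L : MvPolynomial σ F →ₗ[F] Matrix ι ι F)
    (Ψ : MvPolynomial σ (MvPolynomial τ F)) :
    coeffSpace (symbolicImage L Ψ) = (Submodule.span F (paramImage Ψ)).map L := by
  have hfun : (fun e : τ →₀ ℕ => (symbolicImage L Ψ).map (coeff e)) = L ∘ fun e => yCoeff e Ψ :=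
    funext fun e => symbolicImage_map_coeff L Ψ e
  rw [coeffSpace, span_paramImage_eq_span_yCoeff, ← Submodule.span_image, ← Set.range_comp, hfun]

omit [Fintype ι] in
variable [Infinite F] in
/-- `𝒞(L(ψ)) = L(Ŝ)` as sets of matrices. [cite: EfremenkoGargOliveiraWigderson2018, §5, p. 15] locator: paper:arxiv-1710.09502 p0015.txt:L23 -/
theorem coe_coeffSpace_symbolicImage (L : MvPolynomial σ F →ₗ[F] Matrix ι ι F)
    (Ψ : MvPolynomial σ (MvPolynomial τ F)) :
    (coeffSpace (symbolicImage L Ψ) : Set (Matrix ι ι F)) =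
      L '' (Submodule.span F (paramImage Ψ) : Set (MvPolynomial σ F)) := by
  rw [coeffSpace_symbolicImage, Submodule.map_coe]

variable [Infinite F] in
/-- **`rk(𝒞(L(ψ))) = μ_L(Ŝ)`:** the rank of the coefficient space of `L(ψ)` is the largest rank of `L` on
`Ŝ`. [cite: EfremenkoGargOliveiraWigderson2018, §5, p. 15] locator: paper:arxiv-1710.09502 p0015.txt:L23 -/
theorem matrixSetRank_coeffSpace_symbolicImage (L : MvPolynomial σ F →ₗ[F] Matrix ι ι F)
    (Ψ : MvPolynomial σ (MvPolynomial τ F)) :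
    matrixSetRank (coeffSpace (symbolicImage L Ψ) : Set (Matrix ι ι F)) =
      matrixSetRank (L '' (Submodule.span F (paramImage Ψ) : Set (MvPolynomial σ F))) := by
  rw [coe_coeffSpace_symbolicImage]

variable [Infinite F] in
/-- **EGOW 2018, §5, "Restatement of the rank methods" (p. 15), for a fixed rank method `L`.** With
`S = ψ(F^t)` and `Ŝ = span(S)`: the method `μ_L = rank ∘ L` proves a lower bound of `R` for `Ŝ` — some
`f ∈ Ŝ` has `μ_L(f) ≥ R · μ_L(S)` (§1.1: `c_S(f) ≥ μ_L(f)/μ_L(S)`) — if and only if the symbolic matrix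
`L(ψ)` has `rk_{F(y)}(L(ψ)) ≤ r` and `rk(𝒞(L(ψ))) ≥ r · R` for some `r` (infinite `F`; paper: characteristic
zero). When `μ_L(S) = 0` both sides hold trivially (`f = 0`, `r = 0`), matching the vacuity of the printed
ratio. [cite: EfremenkoGargOliveiraWigderson2018, §5 Restatement, p. 15] locator: paper:arxiv-1710.09502 p0015.txt:L22 -/
theorem EGOW2018_sec5_restatement (Ψ : MvPolynomial σ (MvPolynomial τ F))
    (L : MvPolynomial σ F →ₗ[F] Matrix ι ι F) (R : ℕ) :
    (∃ f ∈ Submodule.span F (paramImage Ψ),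
        R * matrixSetRank (L '' paramImage Ψ) ≤ (L f).rank) ↔
      ∃ r : ℕ, symbolicRank (symbolicImage L Ψ) ≤ r ∧
        r * R ≤ matrixSetRank (coeffSpace (symbolicImage L Ψ) : Set (Matrix ι ι F)) := by
  rw [matrixSetRank_image_paramImage, matrixSetRank_coeffSpace_symbolicImage]
  constructor
  · rintro ⟨f, hf, hR⟩
    refine ⟨_, le_rfl, ?_⟩
    rw [Nat.mul_comm]
    exact hR.trans (rank_le_matrixSetRank ⟨f, hf, rfl⟩)
  · rintro ⟨r, hr, hR⟩
    obtain ⟨N, ⟨f, hf, rfl⟩, hN⟩ := exists_rank_eq_matrixSetRank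
      (𝓜 := L '' (Submodule.span F (paramImage Ψ) : Set (MvPolynomial σ F)))
      ⟨L 0, ⟨0, Submodule.zero_mem _, rfl⟩⟩
    refine ⟨f, hf, ?_⟩
    rw [hN]
    calc R * symbolicRank (symbolicImage L Ψ) ≤ R * r := Nat.mul_le_mul_left _ hr
      _ = r * R := Nat.mul_comm _ _
      _ ≤ _ := hR

omit [Fintype ι] in
variable [Infinite F] in
/-- **EGOW 2018, §5, "Restatement of the rank methods", as printed (p. 15):** "there exists a rank method
which proves a lower bound of `R` for the circuit class `Ŝ` if and only if there exists a matrix `L` with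
entries from `𝓛` such that `rk_{F(y)}(L) ≤ r` and `rk(𝒞(L)) ≥ rR` for some `r`" — rank methods are the
linear maps `L : F[x] → Mat_m(F)` with measure `μ_L = rankMeasure L` (§1.1, tree `rankMeasure`), matrices
range over `Mat_m(F[y])` with all entries in `𝓛_S = entrySpace Ψ`, for every size `m` (infinite `F`).
[cite: EfremenkoGargOliveiraWigderson2018, §5 Restatement, p. 15] locator: paper:arxiv-1710.09502 p0015.txt:L22 -/
theorem EGOW2018_sec5_restatement_entries (Ψ : MvPolynomial σ (MvPolynomial τ F)) (R : ℕ) :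
    (∃ (m : ℕ) (L : MvPolynomial σ F →ₗ[F] Matrix (Fin m) (Fin m) F),
        ∃ f ∈ Submodule.span F (paramImage Ψ),
          R * matrixSetRank (L '' paramImage Ψ) ≤ rankMeasure L f) ↔
      ∃ (m : ℕ) (M : Matrix (Fin m) (Fin m) (MvPolynomial τ F)),
        (∀ i j, M i j ∈ entrySpace Ψ) ∧
          ∃ r : ℕ, symbolicRank M ≤ r ∧
            r * R ≤ matrixSetRank (coeffSpace M : Set (Matrix (Fin m) (Fin m) F)) := by
  constructor
  · rintro ⟨m, L, h⟩
    exact ⟨m, symbolicImage L Ψ, symbolicImage_mem_entrySpace L Ψ,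
      (EGOW2018_sec5_restatement Ψ L R).1 h⟩
  · rintro ⟨m, M, hM, h⟩
    choose ℓ hℓ using fun i j => mem_entrySpace_iff.1 (hM i j)
    have hLM : symbolicImage (matrixOfFunctionals ℓ) Ψ = M := by
      rw [symbolicImage_matrixOfFunctionals]
      exact Matrix.ext fun i j => hℓ i j
    subst hLM
    exact ⟨m, matrixOfFunctionals ℓ, (EGOW2018_sec5_restatement Ψ _ R).2 h⟩

end Parametrisation

/-! ## The depth-3 instantiation (p. 15–16) -/

section DepthThree

variable {F : Type*} [Field F] {n : ℕ}

/-- **`S_D` is the image of `ψ`:** the simple polynomials `Sym_d(ℓ_1, …, ℓ_D)` of the depth-3 instantiation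
are exactly the values of the parameter map `ψ` of eq. (5.1) ("`ψ : F^{Dn} → F[y][x]_d`", p. 15; tree
`map_eval_depthThreePsi`). [cite: EfremenkoGargOliveiraWigderson2018, §5 eq. (5.1), p. 15] locator: paper:arxiv-1710.09502 p0015.txt:L49 -/
theorem depthThreeSimple_eq_paramImage (d D : ℕ) :
    depthThreeSimple F n d D = paramImage (depthThreePsi F n d D) := by
  ext p
  constructor
  · rintro ⟨ℓ, rfl⟩
    exact ⟨fun q => ℓ q.1 q.2, map_eval_depthThreePsi d D ℓ⟩
  · rintro ⟨a, rfl⟩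
    exact ⟨fun i j => a (i, j), (map_eval_depthThreePsi d D fun i j => a (i, j)).symm⟩

/-- A homogeneous degree-`d` polynomial with a depth-3 form (`HasDepthThreeForm`, top fan-in `s`, product
fan-in `D`) lies in `Ŝ_D = span(S_D)` ("`f = ∑ α_i Sym_d(ℓ_{i1}, …, ℓ_{iD})`", tree
`eq_sum_smul_symLinear_of_hasDepthThreeForm`). [cite: EfremenkoGargOliveiraWigderson2018, §5, p. 15] locator: paper:arxiv-1710.09502 p0015.txt:L38 -/
theorem mem_span_depthThreeSimple_of_hasDepthThreeForm {d s D : ℕ} {f : MvPolynomial (Fin n) F}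
    (hf : f.IsHomogeneous d) (hform : HasDepthThreeForm f s D) :
    f ∈ Submodule.span F (depthThreeSimple F n d D) := by
  obtain ⟨α, ℓ, hfeq⟩ := hform
  rw [eq_sum_smul_symLinear_of_hasDepthThreeForm hf hfeq]
  exact Submodule.sum_mem _ fun i _ => Submodule.smul_mem _ _ (Submodule.subset_span ⟨ℓ i, rfl⟩)

variable [Infinite F]

/-- **"Let `r` be the rank of the symbolic matrix `L(ψ)`"** (p. 16, third bullet): for the depth-3
instantiation `r = rk_{F(y)}(L(ψ))` is the largest rank of `L` on `S_D` (infinite `F`).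
[cite: EfremenkoGargOliveiraWigderson2018, §5, p. 16] locator: paper:arxiv-1710.09502 p0016.txt:L5 -/
theorem symbolicRank_symbolicImage_depthThreePsi {m : ℕ} (d D : ℕ)
    (L : MvPolynomial (Fin n) F →ₗ[F] Matrix (Fin m) (Fin m) F) :
    symbolicRank (symbolicImage L (depthThreePsi F n d D)) =
      matrixSetRank (L '' depthThreeSimple F n d D) := by
  rw [depthThreeSimple_eq_paramImage, matrixSetRank_image_paramImage]

/-- **"the rank of the space of matrices given by `L(Ŝ_D)`"** (p. 16, last bullet) is `rk(𝒞(L(ψ)))`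
(infinite `F`). [cite: EfremenkoGargOliveiraWigderson2018, §5, p. 16] locator: paper:arxiv-1710.09502 p0016.txt:L8 -/
theorem matrixSetRank_coeffSpace_depthThreePsi {m : ℕ} (d D : ℕ)
    (L : MvPolynomial (Fin n) F →ₗ[F] Matrix (Fin m) (Fin m) F) :
    matrixSetRank (coeffSpace (symbolicImage L (depthThreePsi F n d D)) :
        Set (Matrix (Fin m) (Fin m) F)) =
      matrixSetRank (L '' (Submodule.span F (depthThreeSimple F n d D) :
        Set (MvPolynomial (Fin n) F))) := by
  rw [depthThreeSimple_eq_paramImage, matrixSetRank_coeffSpace_symbolicImage]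

/-- **The restatement for depth-3 formulas** (pp. 15–16): a rank method `L` proves a lower bound of `R`
for `Ŝ_D` — some `f ∈ Ŝ_D` has `μ_L(f) ≥ R · μ_L(S_D)`, which by sub-additivity (tree
`rank_le_of_hasDepthThreeForm`: `μ_L(f) ≤ s · μ_L(S_D)`) forces every depth-3 form of a homogeneous
degree-`d` such `f` to have top fan-in `s` with `s · μ_L(S_D) ≥ R · μ_L(S_D)` — iff `rk_{F(y)}(L(ψ)) ≤ r`
and `rk(𝒞(L(ψ))) ≥ r · R` for some `r` (infinite `F`).
[cite: EfremenkoGargOliveiraWigderson2018, §5, pp. 15–16] locator: paper:arxiv-1710.09502 p0016.txt:L1 -/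
theorem EGOW2018_sec5_restatement_depthThree {m : ℕ} (d D R : ℕ)
    (L : MvPolynomial (Fin n) F →ₗ[F] Matrix (Fin m) (Fin m) F) :
    (∃ f ∈ Submodule.span F (depthThreeSimple F n d D),
        R * matrixSetRank (L '' depthThreeSimple F n d D) ≤ rankMeasure L f) ↔
      ∃ r : ℕ, symbolicRank (symbolicImage L (depthThreePsi F n d D)) ≤ r ∧
        r * R ≤ matrixSetRank (coeffSpace (symbolicImage L (depthThreePsi F n d D)) :
          Set (Matrix (Fin m) (Fin m) F)) := by
  rw [depthThreeSimple_eq_paramImage]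
  exact EGOW2018_sec5_restatement _ L R

omit [Infinite F] in
/-- **Eq. (5.1) in the `x`-grading (erratum note):** the print reads `ψ(y) = H_{2d}[∏_{i=1}^{D} (1 + ∑_j y_{ij} x_j)]`;
`2d` is the total degree in `(x, y)` of the degree-`d` part in `x`, and over `F[y]` the identity is
`H_d[∏_i (1 + ∑_j y_{ij} x_j)] = Sym_d(∑_j y_{1j} x_j, …, ∑_j y_{Dj} x_j) = ψ(y)` — proved here for the
tree's `depthThreePsi`. [cite: EfremenkoGargOliveiraWigderson2018, §5 eq. (5.1), p. 15] locator: paper:arxiv-1710.09502 p0015.txt:L49 -/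
theorem homogeneousComponent_prod_one_add_eq_depthThreePsi (d D : ℕ) :
    homogeneousComponent d
        (∏ i : Fin D, (1 + ∑ j : Fin n,
          C (X (i, j)) * (X j : MvPolynomial (Fin n) (MvPolynomial (Fin D × Fin n) F)))) =
      depthThreePsi F n d D := by
  classical
  rw [Finset.prod_one_add, map_sum, depthThreePsi, Finset.esymm_map_val,
    Finset.powersetCard_eq_filter, Finset.sum_filter]
  refine Finset.sum_congr rfl fun t _ => ?_
  have hhom : (∏ i ∈ t, ∑ j : Fin n, C (X (i, j)) *
      (X j : MvPolynomial (Fin n) (MvPolynomial (Fin D × Fin n) F))).IsHomogeneous t.card := by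
    have h := IsHomogeneous.prod t
      (fun i => ∑ j : Fin n, C (X (i, j)) *
        (X j : MvPolynomial (Fin n) (MvPolynomial (Fin D × Fin n) F)))
      (fun _ => 1)
      (fun i _ => Literature.Barriers.ValiantsHypothesis.isHomogeneous_linearForm
        (fun j => (X (i, j) : MvPolynomial (Fin D × Fin n) F)))
    simpa using h
  rw [homogeneousComponent_of_mem hhom]
  by_cases h : t.card = d
  · rw [if_pos h, if_pos h.symm]
  · rw [if_neg h, if_neg (Ne.symm h)]

end DepthThree

end Literature.Computability.AlgebraicComplexity
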